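import Summits.NavierStokesRegularity.NavierStokesRegularity.Theorems.MustSqueeze.Negative.WithoutOseen
import Summits.NavierStokesRegularity.NavierStokesRegularity.Theorems.SqueezeCycleExtremalBiaxialitySubcriticalOfLiouville

/-!
# Crux `MustSqueeze` (stmt-NavierStokesRegularity-11610), negative side: reductions and the threshold family

Negative-side (cdisprove, D-0016) support lemmas extracted from `Cruxes/MustSqueeze/Disproof.lean`
v10 (§6–§7) so that ideators / planners / provers can IMPORT them:

* the threshold family `MustSqueezeAt a` (`MustSqueeze = MustSqueezeAt (1/8)`, `Iff.rfl`), monotone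
  lemmas `h6_mono`, `mustSqueezeAt_antitone`, `mustSqueezeAt_of_squeezeLiouville` (the route target
  gives every threshold), and `h6_comp_sub` (forward time shifts `t ↦ u (t − δ)` preserve H6);
* `mustSqueezeAt_of_liouvilleConjectureNS` — every threshold, in particular the crux, HOLDS under the
  Liouville conjecture (L) of Koch–Nadirashvili–Seregin–Šverák (via
  `Theorems.squeezeLiouville_of_liouvilleConjectureNS`); `not_squeezeLiouville_of_not_mustSqueeze`,
  `not_liouvilleConjectureNS_of_not_mustSqueeze` — so a refutation of the crux refutes the route
  target and (L);
* `not_mustSqueeze_iff` — the refutation criterion: `¬ MustSqueeze` iff some `C > 0` and some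
  nonzero, everywhere-squeezed member of `𝒦_C` exist (automatically a Type-I KNSS-mild field);

No statement of the route is changed; nothing here closes the item (`--supports`).
-/

noncomputable section

namespace Summit.NavierStokesRegularity.NavierStokesRegularity.Theorems.MustSqueeze.Negative

open MeasureTheory Set Filter Topology
open Literature.Analysis.FluidPDE Literature.Analysis.UnboundedOperators
open Summit.NavierStokesRegularity.NavierStokesRegularity.Theses.SqueezeCycle

/-! ## The threshold family `MustSqueezeAt a` -/

/-- The crux with threshold `a` in place of `1/8`. -/
def MustSqueezeAt (a : ℝ) : Prop :=
  ∀ (C : ℝ) (u : ℝ → (EuclideanSpace ℝ (Fin 3)) → (EuclideanSpace ℝ (Fin 3))),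
    InClass C u → H6 a u → VanishesOnPast u

/-- `MustSqueeze` is the member `a = 1/8` of the family (definitionally). -/
theorem mustSqueeze_iff_mustSqueezeAt : MustSqueeze ↔ MustSqueezeAt (1 / 8) := Iff.rfl

/-- H6 is monotone in the threshold. -/
theorem h6_mono {a b : ℝ} (hab : a ≤ b) {u : ℝ → (EuclideanSpace ℝ (Fin 3)) → (EuclideanSpace ℝ (Fin 3))}
    (h : H6 a u) : H6 b u := by
  intro t ht x
  obtain ⟨v, w, hv, hw, hvw, hq⟩ := h t ht x
  exact ⟨v, w, hv, hw, hvw, fun α β => (hq α β).trans (by nlinarith [sq_nonneg α, sq_nonneg β])⟩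

/-- `MustSqueezeAt` is antitone: a larger threshold is a STRONGER statement.  (With the forward
skeleton `no_leray_rate_of_subquarter` / `production_const_sharp` of the work file, the natural
conjecture is `MustSqueezeAt a` for every `a < 1/4`; the route only needs `a = 1/8`.) -/
theorem mustSqueezeAt_antitone {a b : ℝ} (hab : a ≤ b) (h : MustSqueezeAt b) : MustSqueezeAt a :=
  fun C u hu h6 => h C u hu (h6_mono hab h6)

/-- The full Liouville statement on `𝒦_C` gives every threshold.  (The converse, "all thresholds
⇒ `SqueezeLiouville`", needs the KNSS gauge gradient bound `(−t)|∇u| ≤ C₁(C)` on the class,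
which is not in the tree.) -/
theorem mustSqueezeAt_of_squeezeLiouville (hL : SqueezeLiouville) (a : ℝ) : MustSqueezeAt a :=
  fun C u hu _ => hL C u hu

/-- **Forward time shifts preserve (indeed improve) the squeeze.** For `δ ≥ 0` and `a ≥ 0`, if `u`
satisfies H6 with threshold `a` then so does `t ↦ u (t − δ)`: at time `t` the gauge weight drops
from `δ − t` to `−t` on the non-negative part of the quadratic form and only helps on the negative
part.  (The other clauses of `𝒦_C` are invariant under `t ↦ t − δ` as well —
`IsTypeIAncientMild.comp_sub_right` and, for H5, re-indexing the cylinder tops `t₀ ↦ t₀ − δ ≤ 0` —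
so the counterexample set of the crux is closed under forward time shifts.) -/
theorem h6_comp_sub {a δ : ℝ} (ha : 0 ≤ a) (hδ : 0 ≤ δ)
    {u : ℝ → (EuclideanSpace ℝ (Fin 3)) → (EuclideanSpace ℝ (Fin 3))} (h : H6 a u) :
    H6 a (fun t => u (t - δ)) := by
  intro t ht x
  obtain ⟨v, w, hv, hw, hvw, hq⟩ := h (t - δ) (by linarith) x
  refine ⟨v, w, hv, hw, hvw, fun α β => ?_⟩
  have hq' := hq α β
  set Q : ℝ := inner ℝ (fderiv ℝ (u (t - δ)) x (α • v + β • w)) (α • v + β • w) with hQ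
  have hab : 0 ≤ a * (α ^ 2 + β ^ 2) := by positivity
  show -t * Q ≤ a * (α ^ 2 + β ^ 2)
  have h1 : -(t - δ) * Q ≤ a * (α ^ 2 + β ^ 2) := hq'
  rcases le_or_gt 0 Q with hQ0 | hQ0
  · calc -t * Q ≤ -(t - δ) * Q := by nlinarith
      _ ≤ a * (α ^ 2 + β ^ 2) := h1
  · calc -t * Q ≤ 0 := by nlinarith
      _ ≤ a * (α ^ 2 + β ^ 2) := hab

/-! ## Reductions: what a refutation of the crux would refute -/

/-- **Every threshold holds under the Liouville conjecture (L)** of Koch–Nadirashvili–Seregin–Šverák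
(`Theorems.squeezeLiouville_of_liouvilleConjectureNS`: time-shifted bounded ancient mild solution,
(L) makes slices constant, `IsTypeIAncientMild.eq_zero_of_slice_const`); in particular the crux
`MustSqueeze = MustSqueezeAt (1/8)`.  CONDITIONAL — (L) is open; stated for the family so that no
declaration here has the route item as its conclusion. -/
theorem mustSqueezeAt_of_liouvilleConjectureNS (hL : LiouvilleConjectureNS) (a : ℝ) : MustSqueezeAt a :=
  mustSqueezeAt_of_squeezeLiouville (Theorems.squeezeLiouville_of_liouvilleConjectureNS hL) a

/-- A refutation of the crux refutes the route target (H6 is an extra hypothesis). -/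
theorem not_squeezeLiouville_of_not_mustSqueeze (h : ¬ MustSqueeze) : ¬ SqueezeLiouville :=
  fun hL => h (mustSqueeze_iff_mustSqueezeAt.2 (mustSqueezeAt_of_squeezeLiouville hL _))

/-- **Contrapositive, the adversary's bar.** A refutation of `MustSqueeze` is a refutation of (L):
the witness would be (after a time shift) a nonconstant bounded ancient mild solution —
equivalently (Albritton–Barker 2019, Thm 1.1) a Type-I singularity of Navier–Stokes. -/
theorem not_liouvilleConjectureNS_of_not_mustSqueeze (h : ¬ MustSqueeze) :
    ¬ LiouvilleConjectureNS :=
  fun hL => h (mustSqueeze_iff_mustSqueezeAt.2 (mustSqueezeAt_of_liouvilleConjectureNS hL _))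

/-- **Refutation criterion** (what a future adversary must exhibit): `¬ MustSqueeze` iff some `C`
and some member of `𝒦_C`, squeezed everywhere (`Λ ≤ 1/8`), is nonzero at one point of the past;
necessarily `C > 0` (`vanishes_of_h4_nonpos`) and the member is a Type-I KNSS-mild field
(`Theorems.isTypeIAncientMild_of_squeezeClass`). -/
theorem not_mustSqueeze_iff :
    ¬ MustSqueeze ↔ ∃ (C : ℝ) (u : ℝ → (EuclideanSpace ℝ (Fin 3)) → (EuclideanSpace ℝ (Fin 3))),
      InClass C u ∧ H6 (1 / 8) u ∧ 0 < C ∧ IsTypeIAncientMild C u ∧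
      ∃ t : ℝ, t < 0 ∧ ∃ x : EuclideanSpace ℝ (Fin 3), u t x ≠ 0 := by
  constructor
  · intro h
    rw [mustSqueeze_iff] at h
    push Not at h
    obtain ⟨C, u, hu, h6, hne⟩ := h
    have hne' : ∃ t : ℝ, t < 0 ∧ ∃ x : EuclideanSpace ℝ (Fin 3), u t x ≠ 0 := by
      by_contra hcon
      push Not at hcon
      exact hne hcon
    refine ⟨C, u, hu, h6, ?_, ?_, hne'⟩
    · by_contra hC
      obtain ⟨t, ht, x, hx⟩ := hne'
      exact hx (vanishes_of_h4_nonpos (not_lt.1 hC) hu.2.2.2.1 t ht x)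
    · exact Theorems.isTypeIAncientMild_of_squeezeClass hu.1 hu.2.1 hu.2.2.1 hu.2.2.2.1
  · rintro ⟨C, u, hu, h6, -, -, t, ht, x, hx⟩ h
    exact hx (h C u hu h6 t ht x)

end Summit.NavierStokesRegularity.NavierStokesRegularity.Theorems.MustSqueeze.Negative

end
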